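import Summits.QuantumFields.BalabanUV.Beta.FP.GradedStencilMoments
import Summits.QuantumFields.BalabanUV.Beta.WilsonStencilZ4
import Summits.QuantumFields.BalabanUV.Beta.FP.MarginalUniquenessWardMinimal
import Literature.MathematicalPhysics.QuantumFieldTheory.Balaban1983to89.Beta.StepJetData

/-!
# `BalabanUV.Beta.FP.WilsonCubicGerm` — road «FP» for binder row D1, row H2-G-STENCIL (owner b2b-balaban-beta-d1-p3, journal l.20595 (3)):
# THE CUBIC GERM OF THE WILSON ACTION'S FIELD–FIELD CUBIC STENCIL IS THE YANG–MILLS GERM, COEFFICIENT ONE — `cubicGermOf (wilsonA 3) = ymGerm`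

HONEST DEPENDENCY (page 1, mandatory): continuum YM on T⁴ ⇐ BetaPertH ∧ nine spine estimates (0/9 proved); BetaPertH ⇐ (D1) ∧ (D4) ∧ CAP+tail;
G-an2-4 gates asym, D1 and NE2/3/4.  HONEST FRAMING (cell contract, verbatim): «discharging `BetaPertH` makes Bałaban's UV stability UNCONDITIONAL —
a real constructive-QFT result; it is NOT the continuum limit and NOT the Clay problem.»  THIS MODULE DISCHARGES NOTHING of the wall: it is finite
bookkeeping (list moments of an3-g16's graded `ℤ⁴` transcription `WilsonStencilZ4.wilsonStn` of the Wilson action's `B`-linear one-bond Hessian vertex,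
and a `∑'`-over-`ℤ⁴ × ℤ⁴` ↔ list-sum dictionary) feeding the coefficient tables of `FP/MarginalUniqueness`.  `[our object]`/`[folklore]` throughout; nothing
is cited, no `def … : Prop`, 0 sorry.  NOT the averaging-jet blocks `(inl, inr)`, NOT the transfer to the perfect stencil `SPerfOf`, NOT (H2-b), NOT hasym,
NOT D1, NOT BetaPertH, NOT continuum, NOT Clay.

ABSOLUTE RULE (cell charter, verbatim): «No internally-minted statement may enter as a cited fact. Every hypothesis is either kernel-proved in this package or a
verbatim quotation of a PUBLISHED theorem with page reference. The manuscript(s) under audit are NOT citable for their own disputed steps — they are the thing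
under adjudication; programme-internal (2001/route/tribunal) claims are never citable.»

THE INDEX CONVENTION (statement-first protocol, journal INTENT of b2b-balaban-gan24-formalise-leaf-02-g36).  For a first-order stencil family
`S : Fin 4 → (Fin 4 → ℤ) → MKer 4 (Fib 3)` (background bond `(λ, u)`; rows `(x, inl μ)`, columns `(z, inl ν)` on the field block of the packed fibre),
`cubicGermOf S μ ν λ κ i := ∑' (x, z) ∈ ℤ⁴ × ℤ⁴, S λ 0 x z (inl μ) (inl ν) · (x κ if i = 0, z κ if i = 1)`: leg 1 = the ROW fluctuation leg `(x, μ)` (momentum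
`p`, `i = 0` = first moment in `x_κ`), leg 2 = the COLUMN fluctuation leg `(z, ν)` (momentum `q`, `i = 1` = first moment in `z_κ`), leg 3 = the BACKGROUND bond
`(0, λ)` (momentum `r = −p − q`); moments relative to the background site; colour stripped in an2's `ad(t_c)`-coefficient convention (`StepJetData` §5).  Up to
the common Fourier factor `i·(2π)⁴δ(p+q+r)` these are the coefficients `L μ ν λ κ 0 ∕ 1` of `B¹_μ B²_ν B³_λ p_κ ∕ q_κ` in `MarginalUniqueness`'s encoding.

WHAT IS PROVED (part 2 of 2; part 1 = `FP/GradedStencilMoments`: the list moments `mom0 ∕ momX ∕ momY`, `moments_of_graded`, and the `∑'` ↔ list dictionary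
`hasSum_real_apply_mul`, consumed BY NAME).
* §3 `wEntry 3 λ 0 = real unitVec 0 0 (wilsonStn λ 1)` entrywise on `ℤ⁴` (`WilsonStencilZ4.real_wilsonStn` with `Λ := ℤ⁴`, `lift unitVec = id`).
* §4 FIRST MOMENTS OF THE MAIN STENCIL: `momX (mainStn γ A) κ = [γ = κ]·copies A + 2·spinMat κ γ A`,
  `momY (mainStn γ A) κ = −[γ = κ]·copies A + 2·spinMat κ γ A + 2·dirBlock γ κ A` (`sTot = −2` BY NAME); the remainder `remStn` (`Graded 2`) has none.
* §5 `hasSum_wilsonA_mul` (pairing `wilsonA 3 λ 0` against ANY weight = antisymmetrised list pairing of `wilsonStn λ 1`; `_at`: any site `u`), `tsum_wilsonA_eq_zero` (zeroth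
  moment vanishes), **`cubicGermOf_wilsonA : cubicGermOf (wilsonA 3) = ymGerm`** — the germ of an2's antisymmetrised colourless Wilson table (field–field block = an3's
  `WilsonReflectionFrame.S₀A`) IS the Yang–Mills germ with coefficient EXACTLY `1`; corollaries BY NAME: `WardGerm (cubicGermOf (wilsonA 3)) (quadGerm 1 0 0)`
  (so `cQ = 1` = the germ coefficient of the contact form `Lc`, consistent with `WilsonDivergenceContact.S₀A_div_Z`), `Anti12`, `Anti13`, `FlipInvariant`,
  `PermInvariant`.
Provenance: G-an2-4 formalisation swarm seat b2b-balaban-gan24-formalise-leaf-02 gen 36 (cross-lane on road FP), 2026-08-20.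
-/

noncomputable section

namespace Summit.QuantumFields.BalabanUV.Beta.FP.WilsonCubicGerm

open Finset
open scoped BigOperators
open Literature.MathematicalPhysics.QuantumFieldTheory.Balaban1983to89
open Literature.MathematicalPhysics.QuantumFieldTheory.Balaban1983to89.Beta
open Literature.MathematicalPhysics.QuantumFieldTheory.Balaban1983to89.Beta.DyadicShell (Pt)
open Literature.MathematicalPhysics.QuantumFieldTheory.Balaban1983to89.Beta.GradedBubbles (LP Stn rowSh colSh smulS rowDiff colDiff Graded
  IsStep)
open Literature.MathematicalPhysics.QuantumFieldTheory.Balaban1983to89.Beta.BubbleTable (elemIns elemIns_apply)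
open Literature.MathematicalPhysics.QuantumFieldTheory.Balaban1983to89.Beta.GhostTable (copies)
open Literature.MathematicalPhysics.QuantumFieldTheory.Balaban1983to89.Beta.SpinTable (spinMat spinMat_apply spinDir_apply)
open Literature.MathematicalPhysics.QuantumFieldTheory.Balaban1983to89.Beta.PlaquetteStencil (dirBlock dirBlock_apply)
open Literature.MathematicalPhysics.QuantumFieldTheory.Balaban1983to89.Beta.PlaquetteWeitzenbock (sTot)
open Literature.MathematicalPhysics.QuantumFieldTheory.Balaban1983to89.Beta.StepJetData (wilsonA wEntry)
open Literature.MathematicalPhysics.QuantumFieldTheory.Balaban1983to89.Beta.OneStepResolventKernel (Fib)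
open Literature.MathematicalPhysics.QuantumFieldTheory.Balaban1983to89.Beta.ExpKernelCalculus (MKer)
open Summit.QuantumFields.BalabanUV.Beta.GradedStencilDictionary (real lift real_nil real_cons real_append)
open Summit.QuantumFields.BalabanUV.Beta.FP.GradedStencilMoments
open Summit.QuantumFields.BalabanUV.Beta.WilsonStencilZ4 (pt jointDiff currentStn spinTerm spinStn vecStn divTerm divStn mainStn remStn wilsonStn
  graded_remStn real_wilsonStn)
open Summit.QuantumFields.BalabanUV.Beta.FP.MarginalUniqueness (CubicGerm ymGerm δ δ_comm PermInvariant FlipInvariant Anti12 Anti13 ymGerm_permInvariant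
  ymGerm_anti12 ymGerm_anti13)
open Summit.QuantumFields.BalabanUV.Beta.FP.WardNormalisation (WardGerm quadGerm wardGerm_ymGerm)
open Summit.QuantumFields.BalabanUV.Beta.FP.MarginalUniquenessWardMinimal (flipInvariant_ymGerm)

/-! ## §3 On `ℤ⁴` itself: an2's colourless Wilson entry is the realised Wilson stencil -/

section Lattice

/-- [folklore] on `Λ := ℤ⁴` with the coordinate frame, the additive extension is the identity: `lift unitVec w = w`. -/
theorem lift_unitVec_self (w : Fin 4 → ℤ) : lift (B6BondElimination.unitVec (d := 4)) w = w := by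
  funext j
  simp only [lift, Finset.sum_apply, Pi.smul_apply, B6BondElimination.unitVec_apply, smul_eq_mul, mul_ite, mul_one, mul_zero,
    Finset.sum_ite_eq, Finset.mem_univ, if_true]

/-- [folklore] **an2's colourless Wilson ENTRY at the background site `0` is an ENTRY OF THE REALISED `ℤ⁴` STENCIL** `wilsonStn λ 1`
(`WilsonStencilZ4.real_wilsonStn` on `Λ := ℤ⁴`, colourless instance `C := Unit`, `A := 1`). -/
theorem wEntry_eq_real (lam : Fin 4) (x z : Fin 4 → ℤ) (μ ν : Fin 4) :
    wEntry 3 lam 0 x z μ ν =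
      real (B6BondElimination.unitVec (d := 4)) (0 : Fin 4 → ℤ) 0 (wilsonStn lam (1 : Matrix Unit Unit ℝ)) (x, ((), μ)) (z, ((), ν)) := by
  unfold wEntry
  rw [real_wilsonStn]

/-- [folklore] an2's antisymmetrised field–field block in terms of `wEntry` (definitional). -/
theorem wilsonA_inl_inl (lam : Fin 4) (u x z : Fin 4 → ℤ) (μ ν : Fin 4) :
    wilsonA 3 lam u x z (Sum.inl μ) (Sum.inl ν) = (1 / 2 : ℝ) * (wEntry 3 lam u x z μ ν - wEntry 3 lam u z x ν μ) := rfl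

end Lattice

/-! ## §4 The first moments of the main stencil (current + `sTot`·spin + `2`·longitudinal); the remainder has none -/

section MainMoments

variable {C : Type*}

/-- [folklore] the three moments of the origin pair `pt m`: `m`, `0`, `0`. -/
theorem moments_pt {I : Type*} (m : Matrix I I ℝ) (κ : Fin 4) : mom0 (pt m) = m ∧ momX (pt m) κ = 0 ∧ momY (pt m) κ = 0 := by
  refine ⟨?_, ?_, ?_⟩ <;> simp [pt, mom0, momX, momY]


/-- [folklore] the coordinate of a frame vector: `(unitVec β) κ = [κ = β]` (as a real number). -/
theorem cast_unitVec_apply (β κ : Fin 4) : ((BubbleTransfer.unitVec β κ : ℤ) : ℝ) = if κ = β then 1 else 0 := by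
  rw [BubbleTransfer.unitVec, Pi.single_apply]
  split_ifs <;> simp

/-- [folklore] moments of the joint difference of the origin pair: `mom0 = 0`, `momX = a_κ · m`, `momY = b_κ · m`. -/
theorem moments_jointDiff_pt (a b : Pt) (m : Matrix (C × Fin 4) (C × Fin 4) ℝ) (κ : Fin 4) :
    mom0 (jointDiff a b (pt m)) = 0 ∧ momX (jointDiff a b (pt m)) κ = ((a κ : ℤ) : ℝ) • m ∧ momY (jointDiff a b (pt m)) κ = ((b κ : ℤ) : ℝ) • m := by
  obtain ⟨p0, px, py⟩ := moments_pt m κ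
  obtain ⟨c0, cx, cy⟩ := moments_colSh b (pt m) κ
  obtain ⟨r0, rx, ry⟩ := moments_rowDiff a (colSh b (pt m)) κ
  obtain ⟨d0, dx, dy⟩ := moments_colDiff b (pt m) κ
  obtain ⟨j0, jx, jy⟩ := moments_append (rowDiff a (colSh b (pt m))) (colDiff b (pt m)) κ
  rw [jointDiff, j0, jx, jy, r0, rx, ry, d0, dx, dy, c0, p0, zero_add, zero_add, add_zero]
  exact ⟨rfl, rfl, rfl⟩

/-- [folklore] first moments of the COLOUR CURRENT: `momX = [κ = γ]·copies A`, `momY = −[κ = γ]·copies A`. -/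
theorem moments_currentStn (γ : Fin 4) (A : Matrix C C ℝ) (κ : Fin 4) :
    momX (currentStn γ A) κ = (if κ = γ then (1 : ℝ) else 0) • copies (Fin 4) A ∧
      momY (currentStn γ A) κ = -((if κ = γ then (1 : ℝ) else 0) • copies (Fin 4) A) := by
  obtain ⟨p0, px, py⟩ := moments_pt (copies (Fin 4) A) κ
  obtain ⟨r0, rx, ry⟩ := moments_rowDiff (BubbleTransfer.unitVec γ) (pt (copies (Fin 4) A)) κ
  obtain ⟨d0, dx, dy⟩ := moments_colDiff (BubbleTransfer.unitVec γ) (pt (copies (Fin 4) A)) κ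
  obtain ⟨s0, sx, sy⟩ := moments_smulS (-1 : ℝ) (colDiff (BubbleTransfer.unitVec γ) (pt (copies (Fin 4) A))) κ
  obtain ⟨j0, jx, jy⟩ := moments_append (rowDiff (BubbleTransfer.unitVec γ) (pt (copies (Fin 4) A)))
    (smulS (-1) (colDiff (BubbleTransfer.unitVec γ) (pt (copies (Fin 4) A)))) κ
  rw [currentStn, jx, jy, rx, ry, sx, sy, dx, dy, p0, cast_unitVec_apply, smul_zero, add_zero, zero_add, neg_one_smul]
  exact ⟨rfl, rfl⟩

/-- [folklore] first moments of ONE SPIN TERM: `momX = momY = −[κ = β]·spinMat β γ A`. -/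
theorem moments_spinTerm (γ : Fin 4) (A : Matrix C C ℝ) (β κ : Fin 4) :
    momX (spinTerm γ A β) κ = -((if κ = β then (1 : ℝ) else 0) • spinMat β γ A) ∧
      momY (spinTerm γ A β) κ = -((if κ = β then (1 : ℝ) else 0) • spinMat β γ A) := by
  obtain ⟨-, hx, hy⟩ := moments_jointDiff_pt (-BubbleTransfer.unitVec β) (-BubbleTransfer.unitVec β) (spinMat β γ A) κ
  rw [spinTerm, hx, hy, Pi.neg_apply, Int.cast_neg, cast_unitVec_apply, neg_smul]
  exact ⟨rfl, rfl⟩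

/-- [folklore] first moments of the SPIN STENCIL: `momX = momY = −spinMat κ γ A`. -/
theorem moments_spinStn (γ : Fin 4) (A : Matrix C C ℝ) (κ : Fin 4) :
    momX (spinStn γ A) κ = -spinMat κ γ A ∧ momY (spinStn γ A) κ = -spinMat κ γ A := by
  have hx : ∀ β, momX (spinTerm γ A β) κ = -((if κ = β then (1 : ℝ) else 0) • spinMat β γ A) := fun β => (moments_spinTerm γ A β κ).1
  have hy : ∀ β, momY (spinTerm γ A β) κ = -((if κ = β then (1 : ℝ) else 0) • spinMat β γ A) := fun β => (moments_spinTerm γ A β κ).2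
  have hs : ∀ f : Fin 4 → Matrix (C × Fin 4) (C × Fin 4) ℝ,
      -((if κ = 0 then (1 : ℝ) else 0) • f 0) + -((if κ = 1 then (1 : ℝ) else 0) • f 1) + -((if κ = 2 then (1 : ℝ) else 0) • f 2) +
        -((if κ = 3 then (1 : ℝ) else 0) • f 3) = -f κ := by
    intro f
    fin_cases κ <;> simp
  refine ⟨?_, ?_⟩
  · simp only [spinStn, (moments_append _ _ κ).2.1, hx]
    exact hs fun β => spinMat β γ A
  · simp only [spinStn, (moments_append _ _ κ).2.2, hy]
    exact hs fun β => spinMat β γ A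

/-- [folklore] first moments of ONE LONGITUDINAL TERM: `momX = 0`, `momY = [κ = μ]·dirBlock γ μ A`. -/
theorem moments_divTerm (γ : Fin 4) (A : Matrix C C ℝ) (μ κ : Fin 4) :
    momX (divTerm γ A μ) κ = 0 ∧ momY (divTerm γ A μ) κ = (if κ = μ then (1 : ℝ) else 0) • dirBlock γ μ A := by
  obtain ⟨p0, px, py⟩ := moments_pt (dirBlock γ μ A) κ
  obtain ⟨d0, dx, dy⟩ := moments_colDiff (-BubbleTransfer.unitVec μ) (pt (dirBlock γ μ A)) κ
  obtain ⟨c0, cx, cy⟩ := moments_colSh (BubbleTransfer.unitVec γ) (colDiff (-BubbleTransfer.unitVec μ) (pt (dirBlock γ μ A))) κ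
  obtain ⟨s0, sx, sy⟩ := moments_smulS (-1 : ℝ)
    (colSh (BubbleTransfer.unitVec γ) (colDiff (-BubbleTransfer.unitVec μ) (pt (dirBlock γ μ A)))) κ
  rw [divTerm, sx, sy, cx, cy, dx, dy, d0, p0, Pi.neg_apply, Int.cast_neg, cast_unitVec_apply]
  refine ⟨by rw [smul_zero], ?_⟩
  simp only [smul_zero, add_zero, neg_smul, one_smul, neg_neg]

/-- [folklore] first moments of the LONGITUDINAL STENCIL: `momX = 0`, `momY = dirBlock γ κ A`. -/
theorem moments_divStn (γ : Fin 4) (A : Matrix C C ℝ) (κ : Fin 4) :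
    momX (divStn γ A) κ = 0 ∧ momY (divStn γ A) κ = dirBlock γ κ A := by
  have hx : ∀ μ, momX (divTerm γ A μ) κ = 0 := fun μ => (moments_divTerm γ A μ κ).1
  have hy : ∀ μ, momY (divTerm γ A μ) κ = (if κ = μ then (1 : ℝ) else 0) • dirBlock γ μ A := fun μ => (moments_divTerm γ A μ κ).2
  have hs : ∀ f : Fin 4 → Matrix (C × Fin 4) (C × Fin 4) ℝ,
      (if κ = 0 then (1 : ℝ) else 0) • f 0 + (if κ = 1 then (1 : ℝ) else 0) • f 1 + (if κ = 2 then (1 : ℝ) else 0) • f 2 +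
        (if κ = 3 then (1 : ℝ) else 0) • f 3 = f κ := by
    intro f
    fin_cases κ <;> simp
  refine ⟨?_, ?_⟩
  · simp only [divStn, (moments_append _ _ κ).2.1, hx, add_zero]
  · simp only [divStn, (moments_append _ _ κ).2.2, hy]
    exact hs fun μ => dirBlock γ μ A

/-- [folklore] **FIRST MOMENTS OF THE MAIN STENCIL** (`mainStn γ A = currentStn γ A ++ sTot•spinStn γ A ++ 2•divStn γ A`, `sTot = −2`):
`momX = [κ = γ]·copies A + 2·spinMat κ γ A`, `momY = −[κ = γ]·copies A + 2·spinMat κ γ A + 2·dirBlock γ κ A`. -/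
theorem moments_mainStn (γ : Fin 4) (A : Matrix C C ℝ) (κ : Fin 4) :
    momX (mainStn γ A) κ = (if κ = γ then (1 : ℝ) else 0) • copies (Fin 4) A + (2 : ℝ) • spinMat κ γ A ∧
      momY (mainStn γ A) κ =
        -((if κ = γ then (1 : ℝ) else 0) • copies (Fin 4) A) + (2 : ℝ) • spinMat κ γ A + (2 : ℝ) • dirBlock γ κ A := by
  obtain ⟨cx, cy⟩ := moments_currentStn γ A κ
  obtain ⟨sx, sy⟩ := moments_spinStn γ A κ
  obtain ⟨dx, dy⟩ := moments_divStn γ A κ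
  have h2 : (sTot : ℝ) = -2 := rfl
  refine ⟨?_, ?_⟩
  · rw [mainStn, (moments_append _ _ κ).2.1, vecStn, (moments_append _ _ κ).2.1, (moments_smulS _ _ κ).2.1,
      (moments_smulS _ _ κ).2.1, cx, sx, dx, h2, smul_zero, add_zero, smul_neg, neg_smul, neg_neg]
  · rw [mainStn, (moments_append _ _ κ).2.2, vecStn, (moments_append _ _ κ).2.2, (moments_smulS _ _ κ).2.2,
      (moments_smulS _ _ κ).2.2, cy, sy, dy, h2, smul_neg, neg_smul, neg_neg]

/-- [folklore] **THE REMAINDER STENCIL HAS NO FIRST MOMENTS** (`Graded 2`, `WilsonStencilZ4.graded_remStn`). -/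
theorem moments_remStn (γ : Fin 4) (A : Matrix C C ℝ) (κ : Fin 4) : momX (remStn γ A) κ = 0 ∧ momY (remStn γ A) κ = 0 :=
  (moments_of_graded (graded_remStn γ A)).2 le_rfl κ

/-- [folklore] hence the first moments of the WHOLE Wilson stencil are those of the main stencil. -/
theorem moments_wilsonStn (γ : Fin 4) (A : Matrix C C ℝ) (κ : Fin 4) :
    momX (wilsonStn γ A) κ = momX (mainStn γ A) κ ∧ momY (wilsonStn γ A) κ = momY (mainStn γ A) κ := by
  obtain ⟨-, hx, hy⟩ := moments_append (mainStn γ A) (remStn γ A) κ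
  obtain ⟨rx, ry⟩ := moments_remStn γ A κ
  rw [wilsonStn, hx, hy, rx, ry, add_zero, add_zero]
  exact ⟨rfl, rfl⟩

/-- [folklore] the zeroth moment of the whole Wilson stencil vanishes (`Graded 1`). -/
theorem mom0_wilsonStn (γ : Fin 4) (A : Matrix C C ℝ) : mom0 (wilsonStn γ A) = 0 :=
  (moments_of_graded (WilsonStencilZ4.graded_wilsonStn γ A)).1 le_rfl

end MainMoments

/-! ## §5 The cubic germ of a first-order stencil family; the Wilson germ IS the Yang–Mills germ -/

section Germ

/-- [our object] **THE CUBIC GERM of a first-order stencil family on the packed fibre of `ℤ⁴`** (the INDEX CONVENTION of the module docstring):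
`cubicGermOf S μ ν λ κ i = Σ'_{(x,z)} S λ 0 x z (inl μ) (inl ν) · (x_κ if i = 0, z_κ if i = 1)` — the first moments, relative to the background site, of
the field–field block of the member with background bond `(λ, 0)`. -/
def cubicGermOf (S : Fin 4 → (Fin 4 → ℤ) → MKer 4 (Fib 3)) : CubicGerm :=
  fun μ ν lam κ i => ∑' xz : (Fin 4 → ℤ) × (Fin 4 → ℤ),
    S lam 0 xz.1 xz.2 (Sum.inl μ) (Sum.inl ν) * (((if i = 0 then xz.1 κ else xz.2 κ) : ℤ) : ℝ)

/-- [folklore] **THE ANTISYMMETRISED PAIRING DICTIONARY**: for EVERY weight `φ` on pairs of sites, pairing an2's level-0 Wilson table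
(background bond `(λ, 0)`, field–field block) against `φ` over all of `ℤ⁴ × ℤ⁴` is the antisymmetrised list pairing of an3-g16's `wilsonStn λ 1`. -/
theorem hasSum_wilsonA_mul (lam μ ν : Fin 4) (φ : (Fin 4 → ℤ) → (Fin 4 → ℤ) → ℝ) :
    HasSum (fun xz : (Fin 4 → ℤ) × (Fin 4 → ℤ) => wilsonA 3 lam 0 xz.1 xz.2 (Sum.inl μ) (Sum.inl ν) * φ xz.1 xz.2)
      ((1 / 2 : ℝ) *
        ((((wilsonStn lam (1 : Matrix Unit Unit ℝ)).map fun p => p.m ((), μ) ((), ν) * φ p.x p.y).sum) -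
          ((wilsonStn lam (1 : Matrix Unit Unit ℝ)).map fun p => p.m ((), ν) ((), μ) * φ p.y p.x).sum)) := by
  have h1 := hasSum_real_apply_mul (B6BondElimination.unitVec (d := 4)) (wilsonStn lam (1 : Matrix Unit Unit ℝ)) ((), μ) ((), ν) φ
  have h2 := hasSum_real_apply_mul_swap (B6BondElimination.unitVec (d := 4)) (wilsonStn lam (1 : Matrix Unit Unit ℝ)) ((), ν) ((), μ) φ
  simp only [lift_unitVec_self] at h1 h2
  refine ((h1.sub h2).mul_left (1 / 2 : ℝ)).congr_fun fun xz => ?_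
  rw [wilsonA_inl_inl, wEntry_eq_real, wEntry_eq_real]
  ring

/-- [folklore] the `∑'` form of the antisymmetrised pairing dictionary. -/
theorem tsum_wilsonA_mul (lam μ ν : Fin 4) (φ : (Fin 4 → ℤ) → (Fin 4 → ℤ) → ℝ) :
    ∑' xz : (Fin 4 → ℤ) × (Fin 4 → ℤ), wilsonA 3 lam 0 xz.1 xz.2 (Sum.inl μ) (Sum.inl ν) * φ xz.1 xz.2 =
      (1 / 2 : ℝ) *
        ((((wilsonStn lam (1 : Matrix Unit Unit ℝ)).map fun p => p.m ((), μ) ((), ν) * φ p.x p.y).sum) -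
          ((wilsonStn lam (1 : Matrix Unit Unit ℝ)).map fun p => p.m ((), ν) ((), μ) * φ p.y p.x).sum) :=
  (hasSum_wilsonA_mul lam μ ν φ).tsum_eq

/-- [folklore] **TRANSLATION COVARIANCE OF THE PAIRING**: the same list pairing computes the pairing of the member with background bond `(λ, u)` at ANY
site `u` against the weight read RELATIVE TO `u` (an2's `wilsonA_translate` + re-indexing `ℤ⁴ × ℤ⁴` by the translation) — the «background site `0`» in
`cubicGermOf` is no restriction. -/
theorem hasSum_wilsonA_mul_at (lam μ ν : Fin 4) (u : Fin 4 → ℤ) (φ : (Fin 4 → ℤ) → (Fin 4 → ℤ) → ℝ) :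
    HasSum (fun xz : (Fin 4 → ℤ) × (Fin 4 → ℤ) => wilsonA 3 lam u xz.1 xz.2 (Sum.inl μ) (Sum.inl ν) * φ (xz.1 - u) (xz.2 - u))
      ((1 / 2 : ℝ) *
        ((((wilsonStn lam (1 : Matrix Unit Unit ℝ)).map fun p => p.m ((), μ) ((), ν) * φ p.x p.y).sum) -
          ((wilsonStn lam (1 : Matrix Unit Unit ℝ)).map fun p => p.m ((), ν) ((), μ) * φ p.y p.x).sum)) := by
  have h := hasSum_wilsonA_mul lam μ ν φ
  have ht := StepJetData.wilsonA_translate (d := 3) lam 0 u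
  rw [zero_add] at ht
  refine (((Equiv.addRight u).prodCongr (Equiv.addRight u)).hasSum_iff).mp (h.congr_fun fun xz => ?_)
  simp only [Function.comp_apply, Equiv.prodCongr_apply, Prod.map_fst, Prod.map_snd, Equiv.coe_addRight, add_sub_cancel_right, ht,
    ExpKernelCalculus.shiftK, add_neg_cancel_right]

/-- [our object] **THE ZEROTH MOMENT OF THE WILSON CUBIC STENCIL VANISHES** (no momentum-independent part of the three-gluon vertex: `wilsonStn` is
`Graded 1`): `Σ'_{(x,z)} wilsonA 3 λ 0 x z (inl μ) (inl ν) = 0`. -/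
theorem tsum_wilsonA_eq_zero (lam μ ν : Fin 4) :
    ∑' xz : (Fin 4 → ℤ) × (Fin 4 → ℤ), wilsonA 3 lam 0 xz.1 xz.2 (Sum.inl μ) (Sum.inl ν) = 0 := by
  have h := tsum_wilsonA_mul lam μ ν fun _ _ => (1 : ℝ)
  simp only [mul_one] at h
  rw [h, ← mom0_apply, ← mom0_apply, mom0_wilsonStn, Matrix.zero_apply, Matrix.zero_apply, sub_zero, mul_zero]

/-- [folklore] THE GERM OF `wilsonA` THROUGH THE LIST MOMENTS of `wilsonStn λ 1`:
`p`-part `= ½·((momX)_{μν} − (momY)_{νμ})`, `q`-part `= ½·((momY)_{μν} − (momX)_{νμ})`. -/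
theorem cubicGermOf_wilsonA_eq_moments (μ ν lam κ : Fin 4) (i : Fin 2) :
    cubicGermOf (wilsonA 3) μ ν lam κ i =
      (1 / 2 : ℝ) *
        (if i = 0 then
          momX (wilsonStn lam (1 : Matrix Unit Unit ℝ)) κ ((), μ) ((), ν) - momY (wilsonStn lam (1 : Matrix Unit Unit ℝ)) κ ((), ν) ((), μ)
        else
          momY (wilsonStn lam (1 : Matrix Unit Unit ℝ)) κ ((), μ) ((), ν) - momX (wilsonStn lam (1 : Matrix Unit Unit ℝ)) κ ((), ν) ((), μ)) := by
  obtain ⟨ax, ay⟩ := moments_apply (wilsonStn lam (1 : Matrix Unit Unit ℝ)) κ ((), μ) ((), ν)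
  obtain ⟨bx, by'⟩ := moments_apply (wilsonStn lam (1 : Matrix Unit Unit ℝ)) κ ((), ν) ((), μ)
  unfold cubicGermOf
  fin_cases i
  · simp only [Fin.zero_eta, Fin.isValue, ↓reduceIte]
    rw [ax, by']
    exact tsum_wilsonA_mul lam μ ν fun x _ => ((x κ : ℤ) : ℝ)
  · simp only [Fin.mk_one, Fin.isValue, one_ne_zero, ↓reduceIte]
    rw [ay, bx]
    exact tsum_wilsonA_mul lam μ ν fun _ z => ((z κ : ℤ) : ℝ)

/-- [folklore] `[a = b]` as `MarginalUniqueness.δ` (definitional). -/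
theorem ite_eq_δ (a b : Fin 4) : (if a = b then (1 : ℝ) else 0) = δ a b := rfl

/-- [folklore] `[a = b ∧ c = d] = δ_{ab}·δ_{cd}`. -/
theorem ite_and_eq_δ_mul (a b c d : Fin 4) : (if a = b ∧ c = d then (1 : ℝ) else 0) = δ a b * δ c d := by
  unfold δ
  by_cases h : a = b <;> by_cases h' : c = d <;> simp [h, h']

/-- [folklore] entries of the colourless blocks in `δ`-language: `copies 1 = δ_{μν}`, `spinMat α β 1 = δ_{αμ}δ_{βν} − δ_{βμ}δ_{αν}`,
`dirBlock α β 1 = δ_{μα}δ_{νβ}` on `Unit × Fin 4`. -/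
theorem blocks_apply_unit (α β μ ν : Fin 4) :
    copies (Fin 4) (1 : Matrix Unit Unit ℝ) ((), μ) ((), ν) = δ μ ν ∧
      spinMat α β (1 : Matrix Unit Unit ℝ) ((), μ) ((), ν) = δ α μ * δ β ν - δ β μ * δ α ν ∧
      dirBlock α β (1 : Matrix Unit Unit ℝ) ((), μ) ((), ν) = δ μ α * δ ν β := by
  refine ⟨?_, ?_, ?_⟩
  · rw [copies, Matrix.blockDiagonal_apply]
    unfold δ
    by_cases h : μ = ν <;> simp [h]
  · rw [spinMat_apply, spinDir_apply, Matrix.one_apply_eq, one_mul, ite_and_eq_δ_mul, ite_and_eq_δ_mul]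
  · rw [dirBlock_apply, Matrix.one_apply_eq, ite_and_eq_δ_mul]

/-- [our object] **THE CUBIC GERM OF THE WILSON ACTION'S FIELD–FIELD CUBIC STENCIL IS THE YANG–MILLS GERM, COEFFICIENT EXACTLY ONE**:
`cubicGermOf (wilsonA 3) = ymGerm`.  (The colour current gives `±[λ=κ]δ_{μν}`, the spin vertex with the Wilson action's total spin coupling
`sTot = −2` gives `2(δ_{μκ}δ_{νλ} − δ_{μλ}δ_{νκ})`, the longitudinal vertex gives the `dirBlock` term, the `Graded 2` remainder gives nothing; the
rest is the polynomial identity in the Kronecker deltas, `ring`.) -/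
theorem cubicGermOf_wilsonA : cubicGermOf (wilsonA 3) = ymGerm := by
  funext μ ν lam κ i
  obtain ⟨wx, wy⟩ := moments_wilsonStn lam (1 : Matrix Unit Unit ℝ) κ
  obtain ⟨mx, my⟩ := moments_mainStn lam (1 : Matrix Unit Unit ℝ) κ
  obtain ⟨c1, s1, -⟩ := blocks_apply_unit κ lam μ ν
  obtain ⟨c2, s2, -⟩ := blocks_apply_unit κ lam ν μ
  obtain ⟨-, -, d1⟩ := blocks_apply_unit lam κ μ ν
  obtain ⟨-, -, d2⟩ := blocks_apply_unit lam κ ν μ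
  rw [cubicGermOf_wilsonA_eq_moments, wx, wy, mx, my]
  simp only [Matrix.add_apply, Matrix.smul_apply, Matrix.neg_apply, smul_eq_mul, c1, s1, c2, s2, d1, d2, ite_eq_δ,
    δ_comm κ lam, δ_comm ν μ, δ_comm κ μ, δ_comm lam ν, δ_comm κ ν, δ_comm μ lam, ymGerm]
  split_ifs <;> ring

/-- [our object] COROLLARY: the Wilson cubic germ satisfies the tree-level WARD identity against the CANONICAL transverse quadratic germ
`|k|²δ − kk` — `cQ = 1` (`WardNormalisation.wardGerm_ymGerm` BY NAME). -/
theorem wardGerm_wilsonA : WardGerm (cubicGermOf (wilsonA 3)) (quadGerm 1 0 0) := by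
  rw [cubicGermOf_wilsonA]; exact wardGerm_ymGerm

/-- [our object] COROLLARY: Bose antisymmetry `1 ↔ 2`, `1 ↔ 3`, reflection and permutation invariance of the Wilson cubic germ (BY NAME from `ymGerm`'s). -/
theorem symmetries_wilsonA :
    Anti12 (cubicGermOf (wilsonA 3)) ∧ Anti13 (cubicGermOf (wilsonA 3)) ∧ FlipInvariant (cubicGermOf (wilsonA 3)) ∧
      PermInvariant (cubicGermOf (wilsonA 3)) := by
  rw [cubicGermOf_wilsonA]; exact ⟨ymGerm_anti12, ymGerm_anti13, flipInvariant_ymGerm, ymGerm_permInvariant⟩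

end Germ

end Summit.QuantumFields.BalabanUV.Beta.FP.WilsonCubicGerm
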